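/-
Copyright: statement-level skeleton of a published paper (lit-balaban cell, Phase-2 proof seat p19, gen 2). No claims beyond
what the kernel checks below.
-/
import Mathlib
import Literature.MathematicalPhysics.QuantumFieldTheory.Balaban1983to89.B3Ineq215Proof

/-!
# B3 — T. Bałaban, *(Higgs)₂,₃ quantum fields in a finite volume. III. Renormalization*, CMP **88** (1983) 411–445
[Balaban1983Higgs3] — (2.15) p. 427: a worked instance (the subgraph `G₁` of p. 425, one scalar line in `d = 3`), showing
that the hypothesis of the landed theorem `Model.ineq215_of_pos` is met and the bound applies

statement-level skeleton of published theorems with citation tags; proofs where landed; nothing here is a claim about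
the Yang–Mills mass gap

PDF held: `paper:balaban1983-higgs-2-3-quantum-fields-finite-volume` (journal page = PDF page + 410); renders
`pub-balaban/b2b-balaban-ref1/pages/1983-cmp88-higgs23-III/1983-cmp88-higgs23-III-p015, p017-x2.png` (pp. 425, 427).

Part of the Phase-2 proof of SKELETON rows **B3.Eq2.15-2.16** (unit `lit-balaban-p19` gen 2; HOME
`run/shared/lean/pub/lit-balaban/`).  NON-VACUITY CHECK of `B3Ineq215Proof`: p. 425 [PDF 15] *"G₁ is formed by the line
l(1) and two vertices at the endpoints of this line"*; p. 427 *"Because D(G₁) > 0 we can make the summation over j"*.  The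
smallest instance — one scalar line between two vertices without η-powers in `d = 3` (each scalar leg has dimension
`−(d−2)/2 = −½`, so the line carries `a = −1`; (2.2): `D(G₁) = (3 + 0) + (3 + 0) − 3 − 1 = 2 > 0`) — is written out as a
`Model`, its quotient `G/G₁` is computed (`rep 1 ≡` the first endpoint), the degree is evaluated by the kernel
(`D_one_eq : D 1 0 = 2`), the hypothesis of `Model.ineq215_of_pos` is discharged (`oneLine_pos`), and the bound (2.15)
is instantiated (`oneLine_ineq215`), with `J(l̃)` non-empty (`zero_mem_Mon`).  Nothing of the paper is asserted.
-/

open Finset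

namespace Literature.MathematicalPhysics.QuantumFieldTheory.Balaban1983to89.B3Ineq215

/-- The subgraph `G₁` of p. 425 as a generalized graph: two vertices, one scalar line `0 → 1`, no η-powers, line dimension
`a = −1` (two scalar legs of dimension `−(d−2)/2 = −½` each, `d = 3`), `L = 2`, `δ₀ = 1`. [cite: Balaban1983Higgs3, (2.15) p.427] -/
noncomputable def oneLine : Model (Fin 2) 1 where
  src := fun _ => 0
  tgt := fun _ => 1
  e := fun _ => 0
  a := fun _ => -1
  d := 3
  L := 2
  δ₀ := 1
  d_pos := by norm_num
  two_le_L := le_rfl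
  δ₀_pos := one_pos

/-- After shrinking the only line, both vertices lie in the block of the first endpoint. [cite: Balaban1983Higgs3, (2.16) p.428] -/
theorem rep_one (v : Fin 2) : oneLine.rep 1 v = 0 := by
  rw [oneLine.rep_succ Nat.zero_lt_one v]
  unfold Model.rho Model.bs Model.bt
  simp only [Model.rep_zero]
  fin_cases v <;> simp [oneLine]

/-- The block of `G/G₁`'s single vertex is everything. [cite: Balaban1983Higgs3, (2.16) p.428] -/
theorem fiber_one : oneLine.fiber 1 0 = Finset.univ := by
  ext v; simp [Model.mem_fiber, rep_one]

/-- Its line set is the single line. [cite: Balaban1983Higgs3, (2.16) p.428] -/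
theorem before_one : oneLine.before 1 0 = Finset.univ := by
  ext l
  simp only [Model.mem_before, rep_one, and_true, Finset.mem_univ, iff_true]
  exact l.isLt

/-- The vertices of `G/G₁`: just `0`. [cite: Balaban1983Higgs3, (2.16) p.428] -/
theorem reps_one : oneLine.reps 1 = {0} := by
  ext b; simp [Model.mem_reps, rep_one, eq_comm]

/-- **(2.2)** evaluated by the kernel: `D(G₁) = (3+0) + (3+0) − 3 + (−1) = 2`. [cite: Balaban1983Higgs3, (2.2) p.423] -/
theorem D_one_eq : oneLine.D 1 0 = 2 := by
  unfold Model.D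
  rw [fiber_one, before_one]
  simp [oneLine]
  norm_num

/-- The hypothesis of `Model.ineq215_of_pos` (p. 426: the subgraphs `G_i` have positive degrees) holds for `G₁`:
`D(G₁) = 2 > 0` (and `G₀` has no component). [cite: Balaban1983Higgs3, (2.15) p.427] -/
theorem oneLine_pos : ∀ i, i ≤ 1 → ∀ b ∈ oneLine.reps i, oneLine.Nontriv i b → 0 < oneLine.D i b := by
  intro i hi b hb hn
  interval_cases i
  · exact absurd hn (by simp [Model.Nontriv, Model.before_zero])
  · rw [reps_one, Finset.mem_singleton] at hb
    subst hb
    rw [D_one_eq]; norm_num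

/-- `J(l̃)` is non-empty as soon as `k ≥ 1` (the assignment `j ≡ 0`). [cite: Balaban1983Higgs3, (2.7) p.424] -/
theorem zero_mem_Mon {k : ℕ} (hk : 1 ≤ k) : (fun _ => 0) ∈ Model.Mon 1 k := by
  rw [Model.mem_Mon]
  exact ⟨fun _ _ _ => le_rfl, fun _ => hk⟩

/-- **(2.15)** instantiated for `G₁`: for every `k` and every placement of the two unit cubes,
`Σ_{j∈J(l̃)} Σ_{{Δ(v)}} Ẽ(G₁(j), {Δ(v)}) ≤ const215` — the landed theorem applies (its hypothesis is `oneLine_pos`).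
[cite: Balaban1983Higgs3, (2.15) p.427] -/
theorem oneLine_ineq215 (k : ℕ) (box : Fin 2 → Fin 3 → ℕ) :
    ∑ j ∈ Model.Mon 1 k, oneLine.W 0 k j box ≤ oneLine.const215 :=
  oneLine.ineq215_of_pos oneLine_pos k box

end Literature.MathematicalPhysics.QuantumFieldTheory.Balaban1983to89.B3Ineq215
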